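import Mathlib.Algebra.MvPolynomial.Funext
import Mathlib.Data.Matrix.ColumnRowPartitioned
import Literature.RingTheory.KrullDimension.TranscendenceDegreeOfPoint
import Literature.Computability.AlgebraicComplexity.Yab15BRank
import HarnessLib

/-!
# Yabe 2015, Thm. 2.4 — the locus `brank ≤ r` is irreducible of dimension `≤ r(2s_k − r)`

Topic `Literature/Computability/AlgebraicComplexity`.  DISCHARGE of the named fact
`yabe2015_thm_2_4` of `Yab15BRank.lean` (A. Yabe, *Bi-polynomial rank and determinantal complexity*,
arXiv:1504.00151, §2.2, Thm. 2.4, p0005:L133–L135, proof p0006:L1–L21):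

  "Let `S := {q ∈ K[x]^{(2k)} | brank(q) ≤ r} ⊆ K^{s_{2k}}`.  Then the Zariski closure `S̄` is an
  irreducible variety having dimension at most `r(2s_k − r)`."

(`K` algebraically closed of characteristic `0`; typed on coefficient vectors, for `r ≤ s_k`: the
vanishing ideal `I(S)` is prime and `dim K[𝓘_{2k}]/I(S) ≤ r(2s_k − r)`.)

## The printed proof and the proof here

Printed: `S = π(Z_r)` for the determinantal variety `Z_r = {X ∈ K^{s_k²} | rank X ≤ r}` and the
linear projection `(π(X))_H = Σ_{I+J=H} X_{I,J}` (p0006:L6–L9), by Thm. 2.1 (`brank(q) ≤ r` iff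
`q = v(x)ᵀ X v(x)` with `rank X ≤ r`, p0006:L11–L14); "it is known that `Z_r` is an irreducible variety
of dimension `r(2s_k − r)` (see, e.g., [Harris 1995])", and the closure of a linear image of an
irreducible variety is irreducible of at most that dimension (p0006:L18–L20).

Here both uses of [Harris 1995] are replaced by explicit PARAMETRIZATIONS, the rest is as printed:

* `rank X ≤ r` iff `X = B·C` with `B ∈ K^{s_k × r}`, `C ∈ K^{r × s_k}`; composed with `π` this says
  `S` is the image of the polynomial map `(B, C) ↦ π(BC)` — which is literally Def. 1.4 /
  Thm. 2.1's correspondence `q = Σ_{i<r} f_i g_i ↔ X = Σ_i f⃗_i g⃗_iᵀ = BC`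
  (`Yabe.range_gramMap_eq`, from the tree's `exists_eq_sum_mul_of_isHomogeneous`,
  `bRank_le_of_eq_sum`, `gramPoly`);
* the Zariski closure of the image of an affine space under a polynomial map is irreducible: its
  vanishing ideal is the kernel of the comorphism `K[y_H] → K[B, C]`, a prime ideal (`K` infinite;
  `Yabe.vanishingIdeal_range_eq_ker`, `MvPolynomial.funext`) — this is part (i);
* for the dimension, `Z_r` (hence `S`) is, up to closure, the image of the SMALLER affine space
  `K^{r²} × K^{r(s_k−r)} × K^{(s_k−r)r}` under `(A, X, Y) ↦ [[A, AX], [YA, YAX]]` (the standard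
  affine chart computation behind `dim Z_r = r(2s_k − r)`: on the dense open set where the leading
  `r × r` blocks `B₁` of `B` and `C₁` of `C` are invertible, `BC = [[A,AX],[YA,YAX]]` with `A = B₁C₁`,
  `X = C₁⁻¹C₂`, `Y = B₂B₁⁻¹`); the two comorphisms have the SAME kernel (a polynomial `P(B,C)`
  vanishing on the chart has `P · det B₁ · det C₁ ≡ 0`, so `P = 0`), and the coordinate ring
  `K[y]/I(S)` therefore embeds in a polynomial ring in `r(2s_k − r)` variables, whence
  `dim = trdeg ≤ r(2s_k − r)` (the tree's `dim = trdeg` for affine domains,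
  `Literature.RingTheory.KrullDimension.ringKrullDim_range_eq_toNat_trdeg`, Matsumura Thm 5.6) —
  this is part (ii).

Only `K` infinite is used (from `IsAlgClosed K`); characteristic `0` is not needed.
Everything is proved; no named facts, no new definitions.

## References

* [Yabe2015] A. Yabe, *Bi-polynomial rank and determinantal complexity*, arXiv:1504.00151 (2015):
  Def. 1.4, Thm. 2.1 (p0005), Thm. 2.4 and its proof (p0005:L133–p0006:L21).
* [Harris1995] J. Harris, *Algebraic Geometry: A First Course*, GTM 133, Prop. 12.2 (dimension of
  determinantal varieties) — the citation of the printed proof, replaced here by the affine chart.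
* [Matsumura1987] H. Matsumura, *Commutative Ring Theory*, Thm 5.6 (`dim = trdeg`, tree).
-/

noncomputable section

open MvPolynomial Matrix Finset

namespace Literature.Computability.AlgebraicComplexity

namespace Yabe

universe u v w w'

/-! ### §1. Polynomial maps of affine spaces: image, vanishing ideal, kernel, dimension -/

section PolyMap

variable {K : Type u} [Field K] {τ : Type w} {υ : Type w'}

/-- Pulling back along a polynomial map `a ↦ (φ_t(a))_t` is evaluating the comorphism
`y_t ↦ φ_t`: `p(φ(a)) = (φ^* p)(a)`. [folklore] -/
private theorem aeval_pointMap (φ : τ → MvPolynomial υ K) (a : υ → K) (p : MvPolynomial τ K) :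
    aeval (fun t => eval a (φ t)) p = eval a (aeval φ p) := by
  have h : (aeval a).comp (aeval φ) = aeval (fun t => aeval a (φ t)) := comp_aeval φ (aeval a)
  change aeval (fun t => aeval a (φ t)) p = aeval a (aeval φ p)
  rw [← h]
  rfl

/-- **The vanishing ideal of the image of an affine space under a polynomial map is the kernel of
its comorphism** (over an infinite field: a polynomial vanishing at every point is zero) — the
algebra behind "the Zariski closure of the (linear) image of the irreducible variety … is
irreducible" (p0006:L18–L20). [cite: Yabe2015, Theorem 2.4 (proof)] -/
theorem vanishingIdeal_range_eq_ker [Infinite K] (φ : τ → MvPolynomial υ K) :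
    MvPolynomial.vanishingIdeal K (Set.range fun a : υ → K => fun t => eval a (φ t)) =
      RingHom.ker (aeval φ : MvPolynomial τ K →ₐ[K] MvPolynomial υ K) := by
  ext p
  rw [mem_vanishingIdeal_iff, RingHom.mem_ker]
  constructor
  · intro h
    apply MvPolynomial.funext
    intro a
    rw [map_zero, ← aeval_pointMap]
    exact h _ ⟨a, rfl⟩
  · rintro h _ ⟨a, rfl⟩
    rw [aeval_pointMap, h, map_zero]

/-- Hence the vanishing ideal of such an image is PRIME (the closure is irreducible).
[cite: Yabe2015, Theorem 2.4 (proof)] -/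
theorem isPrime_vanishingIdeal_range [Infinite K] (φ : τ → MvPolynomial υ K) :
    (MvPolynomial.vanishingIdeal K (Set.range fun a : υ → K => fun t => eval a (φ t))).IsPrime := by
  rw [vanishingIdeal_range_eq_ker]
  exact RingHom.ker_isPrime _

/-- **Dimension of the closure of the image of an affine space** `K^υ` under a polynomial map: the
coordinate ring `K[y_τ] / ker φ^*` embeds into `K[x_υ]`, so its Krull dimension — the transcendence
degree of an affine domain (Matsumura Thm 5.6, tree) — is at most `|υ|` ("its dimension is at most"
that of the source, p0006:L19–L20). [cite: Yabe2015, Theorem 2.4 (proof)] -/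
theorem ringKrullDim_quotient_ker_aeval_le [Finite τ] [Finite υ] (φ : τ → MvPolynomial υ K) :
    ringKrullDim (MvPolynomial τ K ⧸ RingHom.ker (aeval φ : MvPolynomial τ K →ₐ[K] MvPolynomial υ K)) ≤
      Nat.card υ := by
  set f := (aeval φ : MvPolynomial τ K →ₐ[K] MvPolynomial υ K) with hf
  haveI : Algebra.FiniteType K f.range :=
    Algebra.FiniteType.of_surjective f.rangeRestrict f.rangeRestrict_surjective
  rw [ringKrullDim_eq_of_ringEquiv (Ideal.quotientKerEquivRange f).toRingEquiv,
    Literature.RingTheory.KrullDimension.ringKrullDim_range_eq_toNat_trdeg f]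
  have h1 : Algebra.trdeg K f.range ≤ Algebra.trdeg K (MvPolynomial υ K) :=
    trdeg_le_of_injective f.range.val Subtype.val_injective
  have h2 : Algebra.trdeg K (MvPolynomial υ K) = Cardinal.lift.{u} (Cardinal.mk υ) :=
    MvPolynomial.trdeg_of_isDomain
  have h3 : Cardinal.toNat (Algebra.trdeg K f.range) ≤ Nat.card υ := by
    have := Cardinal.toNat_le_toNat h1 (by
      rw [h2, Cardinal.lift_lt_aleph0]; exact Cardinal.lt_aleph0_of_finite υ)
    rwa [h2, Cardinal.toNat_lift] at this
  exact_mod_cast h3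

/-- If two comorphisms have the same kernel, the two closures have the same coordinate ring; used
with a parametrization by FEWER variables to bound the dimension. [folklore] -/
private theorem ringKrullDim_quotient_le_of_ker_eq [Finite τ] {υ' : Type*} [Finite υ']
    (φ : τ → MvPolynomial υ K) (φ' : τ → MvPolynomial υ' K)
    (h : RingHom.ker (aeval φ : MvPolynomial τ K →ₐ[K] MvPolynomial υ K) =
      RingHom.ker (aeval φ' : MvPolynomial τ K →ₐ[K] MvPolynomial υ' K)) :
    ringKrullDim (MvPolynomial τ K ⧸ RingHom.ker (aeval φ : MvPolynomial τ K →ₐ[K] MvPolynomial υ K)) ≤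
      Nat.card υ' := by
  rw [h]
  exact ringKrullDim_quotient_ker_aeval_le φ'

end PolyMap

/-! ### §2. The Gram parametrization `(B, C) ↦ π(BC)` of `S = {brank ≤ r}` (Thm. 2.1, `S = π(Z_r)`) -/

section Gram

variable {K : Type u} [Field K] {σ : Type v} [Fintype σ] [DecidableEq σ] {k : ℕ}

/-- The coefficients of `v(x)ᵀ Q v(x)`: `(π(Q))_H = Σ_{I+J=H} Q_{I,J}` (p0006:L6–L9).
[cite: Yabe2015, Theorem 2.4 (proof, π)] -/
theorem coeff_gramPoly (Q : Matrix (DegIdx σ k) (DegIdx σ k) K) (H : σ →₀ ℕ) :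
    coeff H (gramPoly k Q) = ∑ I : DegIdx σ k, ∑ J : DegIdx σ k, if I.1 + J.1 = H then Q I J else 0 := by
  unfold gramPoly
  rw [coeff_sum]
  refine Finset.sum_congr rfl fun I _ => ?_
  rw [coeff_sum]
  refine Finset.sum_congr rfl fun J _ => ?_
  rw [coeff_monomial]

/-- **`v(x)ᵀ (BC) v(x) = Σ_i (b_iᵀ v(x))(c_i v(x))`** (Thm. 2.1's correspondence between Gram
matrices of rank `≤ r` written as `BC` and decompositions into `r` products of `k`-forms, p0005;
columns `b_i` of `B`, rows `c_i` of `C`). [cite: Yabe2015, Theorem 2.1 (proof)] -/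
theorem gramPoly_mul {r : ℕ} (B : Matrix (DegIdx σ k) (Fin r) K) (C : Matrix (Fin r) (DegIdx σ k) K) :
    gramPoly k (B * C) =
      ∑ i : Fin r, (∑ I : DegIdx σ k, monomial I.1 (B I i)) * (∑ J : DegIdx σ k, monomial J.1 (C i J)) := by
  calc gramPoly k (B * C)
      = ∑ I : DegIdx σ k, ∑ J : DegIdx σ k, ∑ i : Fin r, monomial (I.1 + J.1) (B I i * C i J) := by
        unfold gramPoly
        refine Finset.sum_congr rfl fun I _ => Finset.sum_congr rfl fun J _ => ?_
        rw [Matrix.mul_apply, map_sum]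
    _ = ∑ I : DegIdx σ k, ∑ i : Fin r, ∑ J : DegIdx σ k, monomial (I.1 + J.1) (B I i * C i J) :=
        Finset.sum_congr rfl fun I _ => Finset.sum_comm
    _ = ∑ i : Fin r, ∑ I : DegIdx σ k, ∑ J : DegIdx σ k, monomial (I.1 + J.1) (B I i * C i J) :=
        Finset.sum_comm
    _ = ∑ i : Fin r, (∑ I : DegIdx σ k, monomial I.1 (B I i)) * (∑ J : DegIdx σ k, monomial J.1 (C i J)) := by
        refine Finset.sum_congr rfl fun i _ => ?_
        rw [Finset.sum_mul_sum]
        exact Finset.sum_congr rfl fun I _ => Finset.sum_congr rfl fun J _ => by rw [monomial_mul]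

/-- A sum of degree-`k` monomials is a `k`-form. [folklore] -/
private theorem isHomogeneous_sum_monomial (c : DegIdx σ k → K) :
    (∑ I : DegIdx σ k, monomial I.1 (c I)).IsHomogeneous k :=
  IsHomogeneous.sum _ _ _ fun I _ => isHomogeneous_monomial _ (mem_degMonomials_iff.1 I.2)

/-- A `k`-form is the sum of its degree-`k` monomials (`OrbitCoordinateRing.sum_coeff_smul_monomial_eq`).
[folklore] -/
private theorem eq_sum_monomial_coeff {f : MvPolynomial σ K} (hf : f.IsHomogeneous k) :
    f = ∑ I : DegIdx σ k, monomial I.1 (coeff I.1 f) := by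
  conv_lhs => rw [← sum_coeff_smul_monomial_eq hf]
  exact Finset.sum_congr rfl fun I _ => by rw [smul_monomial, smul_eq_mul, mul_one]

/-- Padding a family indexed by `Fin n`, `n ≤ r`, by zeros to `Fin r` does not change its sum.
[folklore] -/
private theorem sum_dite_fin_eq {M : Type*} [AddCommMonoid M] {n r : ℕ} (h : n ≤ r) (F : Fin n → M) :
    (∑ i : Fin r, if hi : (i : ℕ) < n then F ⟨i, hi⟩ else 0) = ∑ i, F i := by
  classical
  set G : Fin r → M := fun i => if hi : (i : ℕ) < n then F ⟨i, hi⟩ else 0 with hG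
  have hGe : ∀ j : Fin n, G (Fin.castLE h j) = F j := fun j => by
    rw [hG]; simp only [Fin.val_castLE, Fin.is_lt, ↓reduceDIte, Fin.eta]
  calc ∑ i : Fin r, G i = ∑ i ∈ Finset.univ.map (Fin.castLEEmb h), G i := by
        refine (Finset.sum_subset (Finset.subset_univ _) fun i _ hi => ?_).symm
        rw [hG]
        simp only
        split_ifs with hlt
        · exact (hi (Finset.mem_map.2 ⟨⟨i, hlt⟩, Finset.mem_univ _, Fin.ext rfl⟩)).elim
        · rfl
    _ = ∑ j : Fin n, G (Fin.castLEEmb h j) := Finset.sum_map _ _ _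
    _ = ∑ j, F j := Finset.sum_congr rfl fun j _ => hGe j

omit [Fintype σ] in
/-- **`brank(q) ≤ r` gives a decomposition with EXACTLY `r` terms** (pad an optimal one, Def. 1.4,
with zero forms). [cite: Yabe2015, Definition 1.4] -/
theorem exists_eq_sum_fin_of_bRank_le {q : MvPolynomial σ K} (hq : q.IsHomogeneous (2 * k)) {r : ℕ}
    (hr : bRank k q ≤ r) :
    ∃ f g : Fin r → MvPolynomial σ K,
      (∀ i, (f i).IsHomogeneous k) ∧ (∀ i, (g i).IsHomogeneous k) ∧ q = ∑ i, f i * g i := by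
  classical
  obtain ⟨f₀, g₀, hf₀, hg₀, hq₀⟩ := exists_eq_sum_mul_of_isHomogeneous hq
  refine ⟨fun i => if hi : (i : ℕ) < bRank k q then f₀ ⟨i, hi⟩ else 0,
    fun i => if hi : (i : ℕ) < bRank k q then g₀ ⟨i, hi⟩ else 0, fun i => ?_, fun i => ?_, ?_⟩
  · by_cases hi : (i : ℕ) < bRank k q
    · simp only [hi, ↓reduceDIte]; exact hf₀ _
    · simp only [hi, ↓reduceDIte]; exact isHomogeneous_zero σ K k
  · by_cases hi : (i : ℕ) < bRank k q
    · simp only [hi, ↓reduceDIte]; exact hg₀ _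
    · simp only [hi, ↓reduceDIte]; exact isHomogeneous_zero σ K k
  · calc q = ∑ i, f₀ i * g₀ i := hq₀
      _ = ∑ i : Fin r, (if hi : (i : ℕ) < bRank k q then f₀ ⟨i, hi⟩ * g₀ ⟨i, hi⟩ else 0) :=
          (sum_dite_fin_eq hr _).symm
      _ = _ := Finset.sum_congr rfl fun i _ => by
          by_cases hi : (i : ℕ) < bRank k q
          · simp only [hi, ↓reduceDIte]
          · simp only [hi, ↓reduceDIte, mul_zero]

/-- **`S = π(Z_r)` in parametrized form** (p0006:L11–L15 via Thm. 2.1): the coefficient vectors of the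
`2k`-forms of `brank ≤ r` are exactly the values `π(BC)`, `B ∈ K^{s_k × r}`, `C ∈ K^{r × s_k}`.
[cite: Yabe2015, Theorem 2.4 (proof)] -/
theorem range_gramMap_eq (k r : ℕ) :
    Set.range (fun BC : Matrix (DegIdx σ k) (Fin r) K × Matrix (Fin r) (DegIdx σ k) K =>
        formCoeff (2 * k) (gramPoly k (BC.1 * BC.2))) =
      formCoeff (2 * k) '' {q : MvPolynomial σ K | q.IsHomogeneous (2 * k) ∧ bRank k q ≤ r} := by
  classical
  ext y
  constructor
  · rintro ⟨⟨B, C⟩, rfl⟩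
    refine ⟨gramPoly k (B * C), ⟨isHomogeneous_gramPoly _, ?_⟩, rfl⟩
    calc bRank k (gramPoly k (B * C)) ≤ Fintype.card (Fin r) :=
          bRank_le_of_eq_sum (fun i => ∑ I : DegIdx σ k, monomial I.1 (B I i))
            (fun i => ∑ J : DegIdx σ k, monomial J.1 (C i J))
            (fun i => isHomogeneous_sum_monomial _) (fun i => isHomogeneous_sum_monomial _)
            (gramPoly_mul B C)
      _ = r := Fintype.card_fin r
  · rintro ⟨q, ⟨hq, hr⟩, rfl⟩
    obtain ⟨f, g, hf, hg, hqfg⟩ := exists_eq_sum_fin_of_bRank_le hq hr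
    refine ⟨⟨Matrix.of fun I i => coeff I.1 (f i), Matrix.of fun i J => coeff J.1 (g i)⟩, ?_⟩
    simp only
    congr 1
    rw [gramPoly_mul, hqfg]
    refine Finset.sum_congr rfl fun i _ => ?_
    simp only [Matrix.of_apply]
    rw [← eq_sum_monomial_coeff (hf i), ← eq_sum_monomial_coeff (hg i)]

end Gram

/-! ### §3. The comorphism of `π ∘ (B, C) ↦ BC` and part (i): `I(S)` is prime -/

section Comorphism

variable {K : Type u} [Field K] {σ : Type v} [Fintype σ] [DecidableEq σ]

/-- Reading a point of `K^{s_k × r} × K^{r × s_k}` as the pair of matrices `(B, C)`. [folklore] -/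
private theorem range_pointMap_gram (k r : ℕ) :
    Set.range (fun a : (DegIdx σ k × Fin r) ⊕ (Fin r × DegIdx σ k) → K => fun H : DegIdx σ (2 * k) =>
        eval a (∑ I : DegIdx σ k, ∑ J : DegIdx σ k,
          if I.1 + J.1 = H.1 then ∑ i : Fin r, X (Sum.inl (I, i)) * X (Sum.inr (i, J)) else 0)) =
      Set.range (fun BC : Matrix (DegIdx σ k) (Fin r) K × Matrix (Fin r) (DegIdx σ k) K =>
        formCoeff (2 * k) (gramPoly k (BC.1 * BC.2))) := by
  classical
  -- the value of the `H`-th component at `a` is `π(B_a C_a)_H`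
  have key : ∀ a : (DegIdx σ k × Fin r) ⊕ (Fin r × DegIdx σ k) → K, ∀ H : DegIdx σ (2 * k),
      eval a (∑ I : DegIdx σ k, ∑ J : DegIdx σ k,
          if I.1 + J.1 = H.1 then ∑ i : Fin r, X (Sum.inl (I, i)) * X (Sum.inr (i, J)) else 0) =
        formCoeff (2 * k) (gramPoly k
          ((Matrix.of fun I i => a (Sum.inl (I, i))) * (Matrix.of fun i J => a (Sum.inr (i, J))))) H := by
    intro a H
    rw [formCoeff_apply, coeff_gramPoly, map_sum]
    refine Finset.sum_congr rfl fun I _ => ?_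
    rw [map_sum]
    refine Finset.sum_congr rfl fun J _ => ?_
    split_ifs with h
    · rw [map_sum, Matrix.mul_apply]
      refine Finset.sum_congr rfl fun i _ => ?_
      rw [map_mul, eval_X, eval_X, Matrix.of_apply, Matrix.of_apply]
    · rw [map_zero]
  ext y
  constructor
  · rintro ⟨a, rfl⟩
    exact ⟨⟨Matrix.of fun I i => a (Sum.inl (I, i)), Matrix.of fun i J => a (Sum.inr (i, J))⟩,
      funext fun H => (key a H).symm⟩
  · rintro ⟨⟨B, C⟩, rfl⟩
    refine ⟨Sum.elim (fun p => B p.1 p.2) (fun p => C p.1 p.2), ?_⟩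
    funext H
    beta_reduce
    rw [key]
    rfl

/-- **Yabe 2015, Thm. 2.4, part (i): `S̄` is irreducible** — the vanishing ideal of
`S = {brank ≤ r} ⊆ K^{s_{2k}}` is prime, for every field `K` that is infinite (in particular
algebraically closed) and every `r` (p0005:L133–L135). [cite: Yabe2015, Theorem 2.4] -/
theorem isPrime_vanishingIdeal_bRank_le [Infinite K] (k r : ℕ) :
    (MvPolynomial.vanishingIdeal K
      (formCoeff (2 * k) '' {q : MvPolynomial σ K | q.IsHomogeneous (2 * k) ∧ bRank k q ≤ r})).IsPrime := by
  rw [← range_gramMap_eq, ← range_pointMap_gram]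
  exact isPrime_vanishingIdeal_range _

end Comorphism

/-! ### §4. The affine chart `(A, X, Y) ↦ [[A, AX], [YA, YAX]]` of `Z_r` and part (ii) -/

section Chart

variable {K : Type u} [Field K] {s : Type w} {r t : ℕ}

omit [Field K] in
/-- A matrix with rows indexed by `s ≃ Fin r ⊕ Fin t` is the row-partitioned matrix of its two row
blocks. [folklore] -/
private theorem eq_fromRows_submatrix (e : s ≃ Fin r ⊕ Fin t) (B : Matrix s (Fin r) K) :
    B = (Matrix.fromRows (B.submatrix (fun i => e.symm (Sum.inl i)) id)
      (B.submatrix (fun i => e.symm (Sum.inr i)) id)).submatrix e id := by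
  ext I i
  rw [submatrix_apply]
  rcases h : e I with i' | t'
  · rw [fromRows_apply_inl, submatrix_apply, ← h, Equiv.symm_apply_apply]; rfl
  · rw [fromRows_apply_inr, submatrix_apply, ← h, Equiv.symm_apply_apply]; rfl

omit [Field K] in
/-- Same for columns. [folklore] -/
private theorem eq_fromCols_submatrix (e : s ≃ Fin r ⊕ Fin t) (C : Matrix (Fin r) s K) :
    C = (Matrix.fromCols (C.submatrix id (fun j => e.symm (Sum.inl j)))
      (C.submatrix id (fun j => e.symm (Sum.inr j)))).submatrix id e := by
  ext i J
  rw [submatrix_apply]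
  rcases h : e J with j' | t'
  · rw [fromCols_apply_inl, submatrix_apply, ← h, Equiv.symm_apply_apply]; rfl
  · rw [fromCols_apply_inr, submatrix_apply, ← h, Equiv.symm_apply_apply]; rfl

/-- Products of a row-partitioned and a column-partitioned matrix, transported along `e`.
[folklore] -/
private theorem fromRows_submatrix_mul_fromCols_submatrix (e : s ≃ Fin r ⊕ Fin t)
    (B₁ : Matrix (Fin r) (Fin r) K) (B₂ : Matrix (Fin t) (Fin r) K)
    (C₁ : Matrix (Fin r) (Fin r) K) (C₂ : Matrix (Fin r) (Fin t) K) :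
    (Matrix.fromRows B₁ B₂).submatrix e id * (Matrix.fromCols C₁ C₂).submatrix id e =
      (Matrix.fromBlocks (B₁ * C₁) (B₁ * C₂) (B₂ * C₁) (B₂ * C₂)).submatrix e e := by
  rw [← Matrix.submatrix_mul _ _ _ _ _ Function.bijective_id, fromRows_mul_fromCols]

/-- **The affine chart of the determinantal variety**: if the leading `r × r` blocks `B₁` of
`B ∈ K^{s × r}` and `C₁` of `C ∈ K^{r × s}` are invertible, then
`BC = [[A, AX], [YA, YAX]]` with `A = B₁C₁`, `X = C₁⁻¹C₂`, `Y = B₂B₁⁻¹` — the standard computation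
behind "`Z_r` is an irreducible variety of dimension `r(2s_k − r)`" ([Harris 1995], quoted at
p0006:L4–L5). [cite: Yabe2015, Theorem 2.4 (proof)] -/
theorem exists_chart_of_det_ne_zero (e : s ≃ Fin r ⊕ Fin t) (B : Matrix s (Fin r) K)
    (C : Matrix (Fin r) s K) (hB : (B.submatrix (fun i => e.symm (Sum.inl i)) id).det ≠ 0)
    (hC : (C.submatrix id (fun j => e.symm (Sum.inl j))).det ≠ 0) :
    ∃ (A : Matrix (Fin r) (Fin r) K) (X : Matrix (Fin r) (Fin t) K) (Y : Matrix (Fin t) (Fin r) K),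
      (Matrix.fromRows A (Y * A)).submatrix e id *
          (Matrix.fromCols (1 : Matrix (Fin r) (Fin r) K) X).submatrix id e = B * C := by
  set B₁ := B.submatrix (fun i => e.symm (Sum.inl i)) id with hB₁
  set B₂ := B.submatrix (fun i => e.symm (Sum.inr i)) id with hB₂
  set C₁ := C.submatrix id (fun j => e.symm (Sum.inl j)) with hC₁
  set C₂ := C.submatrix id (fun j => e.symm (Sum.inr j)) with hC₂
  have hBu : IsUnit B₁.det := isUnit_iff_ne_zero.2 hB
  have hCu : IsUnit C₁.det := isUnit_iff_ne_zero.2 hC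
  refine ⟨B₁ * C₁, C₁⁻¹ * C₂, B₂ * B₁⁻¹, ?_⟩
  conv_rhs => rw [eq_fromRows_submatrix e B, eq_fromCols_submatrix e C]
  rw [fromRows_submatrix_mul_fromCols_submatrix, fromRows_submatrix_mul_fromCols_submatrix,
    Matrix.mul_one, Matrix.mul_one]
  have h2 : B₁ * C₁ * (C₁⁻¹ * C₂) = B₁ * C₂ := by
    rw [Matrix.mul_assoc, Matrix.mul_nonsing_inv_cancel_left C₁ C₂ hCu]
  have h3 : B₂ * B₁⁻¹ * (B₁ * C₁) = B₂ * C₁ := by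
    rw [← Matrix.mul_assoc, Matrix.nonsing_inv_mul_cancel_right B₁ B₂ hBu]
  have h4 : B₂ * C₁ * (C₁⁻¹ * C₂) = B₂ * C₂ := by
    rw [Matrix.mul_assoc, Matrix.mul_nonsing_inv_cancel_left C₁ C₂ hCu]
  rw [h2, h3, h4]

end Chart

section Dimension

variable {K : Type u} [Field K] {σ : Type v} [Fintype σ] [DecidableEq σ]

/-- The value of the `H`-th component of the Gram comorphism at the point `(B, C)` is `π(BC)_H`.
[cite: Yabe2015, Theorem 2.4 (proof, π)] -/
private theorem eval_gramComp {k r : ℕ} (a : (DegIdx σ k × Fin r) ⊕ (Fin r × DegIdx σ k) → K)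
    (H : DegIdx σ (2 * k)) :
    eval a (∑ I : DegIdx σ k, ∑ J : DegIdx σ k,
        if I.1 + J.1 = H.1 then ∑ i : Fin r, X (Sum.inl (I, i)) * X (Sum.inr (i, J)) else 0) =
      formCoeff (2 * k) (gramPoly k
        ((Matrix.of fun I i => a (Sum.inl (I, i))) * (Matrix.of fun i J => a (Sum.inr (i, J))))) H := by
  rw [formCoeff_apply, coeff_gramPoly, map_sum]
  refine Finset.sum_congr rfl fun I _ => ?_
  rw [map_sum]
  refine Finset.sum_congr rfl fun J _ => ?_
  split_ifs with h
  · rw [map_sum, Matrix.mul_apply]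
    refine Finset.sum_congr rfl fun i _ => ?_
    rw [map_mul, eval_X, eval_X, Matrix.of_apply, Matrix.of_apply]
  · rw [map_zero]

/-- **The chart and the Gram map have comorphisms with the same kernel**: a polynomial in the
coefficients `y_H` vanishing on all `π([[A,AX],[YA,YAX]])` vanishes on all `π(BC)` (multiply by
`det B₁ · det C₁` and use the chart), and conversely. [cite: Yabe2015, Theorem 2.4 (proof)] -/
theorem ker_gramComp_eq_ker_chartComp [Infinite K] {k r t : ℕ} (e : DegIdx σ k ≃ Fin r ⊕ Fin t) :
    let φ : DegIdx σ (2 * k) → MvPolynomial ((DegIdx σ k × Fin r) ⊕ (Fin r × DegIdx σ k)) K :=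
      fun H => ∑ I : DegIdx σ k, ∑ J : DegIdx σ k,
        if I.1 + J.1 = H.1 then ∑ i : Fin r, X (Sum.inl (I, i)) * X (Sum.inr (i, J)) else 0
    let θ : (DegIdx σ k × Fin r) ⊕ (Fin r × DegIdx σ k) →
        MvPolynomial ((Fin r × Fin r) ⊕ ((Fin r × Fin t) ⊕ (Fin t × Fin r))) K :=
      fun u => match u with
        | Sum.inl Ii => (Matrix.fromRows
            (Matrix.of fun i j : Fin r => X (Sum.inl (i, j)))
            ((Matrix.of fun (i : Fin t) (j : Fin r) => X (Sum.inr (Sum.inr (i, j)))) *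
              (Matrix.of fun i j : Fin r => X (Sum.inl (i, j))))) (e Ii.1) Ii.2
        | Sum.inr iJ => (Matrix.fromCols (1 : Matrix (Fin r) (Fin r) _)
            (Matrix.of fun (i : Fin r) (j : Fin t) => X (Sum.inr (Sum.inl (i, j))))) iJ.1 (e iJ.2)
    RingHom.ker (aeval φ : MvPolynomial (DegIdx σ (2 * k)) K →ₐ[K] _) =
      RingHom.ker (aeval (fun H => aeval θ (φ H)) : MvPolynomial (DegIdx σ (2 * k)) K →ₐ[K] _) := by
  intro φ θ
  classical
  -- the composite comorphism
  have hcomp : (aeval (fun H => aeval θ (φ H)) : MvPolynomial (DegIdx σ (2 * k)) K →ₐ[K] _) =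
      (aeval θ).comp (aeval φ) := (comp_aeval φ (aeval θ)).symm
  apply le_antisymm
  · intro p hp
    rw [RingHom.mem_ker] at hp ⊢
    rw [hcomp, AlgHom.comp_apply, hp, map_zero]
  · intro p hp
    rw [RingHom.mem_ker] at hp ⊢
    -- `P := φ^* p` satisfies `P · det B₁ · det C₁ ≡ 0`
    set P := aeval φ p with hP
    let Bv : Matrix (DegIdx σ k) (Fin r) (MvPolynomial ((DegIdx σ k × Fin r) ⊕ (Fin r × DegIdx σ k)) K) :=
      Matrix.of fun I i => X (Sum.inl (I, i))
    let Cv : Matrix (Fin r) (DegIdx σ k) (MvPolynomial ((DegIdx σ k × Fin r) ⊕ (Fin r × DegIdx σ k)) K) :=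
      Matrix.of fun i J => X (Sum.inr (i, J))
    set D := (Bv.submatrix (fun i => e.symm (Sum.inl i)) id).det *
      (Cv.submatrix id (fun j => e.symm (Sum.inl j))).det with hD
    -- matrices of a point
    have hBv : ∀ a : (DegIdx σ k × Fin r) ⊕ (Fin r × DegIdx σ k) → K,
        Bv.map (eval a) = Matrix.of fun I i => a (Sum.inl (I, i)) := fun a => by
      ext I i; simp only [Bv, Matrix.map_apply, Matrix.of_apply, eval_X]
    have hCv : ∀ a : (DegIdx σ k × Fin r) ⊕ (Fin r × DegIdx σ k) → K,
        Cv.map (eval a) = Matrix.of fun i J => a (Sum.inr (i, J)) := fun a => by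
      ext i J; simp only [Cv, Matrix.map_apply, Matrix.of_apply, eval_X]
    have hPD : P * D = 0 := by
      apply MvPolynomial.funext
      intro a
      rw [map_zero, map_mul]
      set Ba : Matrix (DegIdx σ k) (Fin r) K := Matrix.of fun I i => a (Sum.inl (I, i)) with hBa
      set Ca : Matrix (Fin r) (DegIdx σ k) K := Matrix.of fun i J => a (Sum.inr (i, J)) with hCa
      have hDa : eval a D = (Ba.submatrix (fun i => e.symm (Sum.inl i)) id).det *
          (Ca.submatrix id (fun j => e.symm (Sum.inl j))).det := by
        rw [hD, map_mul, RingHom.map_det, RingHom.map_det, RingHom.mapMatrix_apply,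
          RingHom.mapMatrix_apply, ← Matrix.submatrix_map, ← Matrix.submatrix_map, hBv, hCv]
      by_cases hdet : (Ba.submatrix (fun i => e.symm (Sum.inl i)) id).det = 0 ∨
          (Ca.submatrix id (fun j => e.symm (Sum.inl j))).det = 0
      · rw [hDa]
        rcases hdet with h | h <;> simp [h]
      · simp only [not_or] at hdet
        obtain ⟨A, Xm, Y, hAXY⟩ := exists_chart_of_det_ne_zero e Ba Ca hdet.1 hdet.2
        -- the point `a' = (A, X, Y)` of the chart maps to the same `BC`
        let a' : (Fin r × Fin r) ⊕ ((Fin r × Fin t) ⊕ (Fin t × Fin r)) → K :=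
          Sum.elim (fun p => A p.1 p.2) (Sum.elim (fun p => Xm p.1 p.2) (fun p => Y p.1 p.2))
        have hθ : (Matrix.of fun I i => (fun u => eval a' (θ u)) (Sum.inl (I, i))) *
            (Matrix.of fun i J => (fun u => eval a' (θ u)) (Sum.inr (i, J))) = Ba * Ca := by
          rw [← hAXY]
          have hA : (Matrix.of fun i j : Fin r => X (Sum.inl (i, j)) :
              Matrix (Fin r) (Fin r) (MvPolynomial _ K)).map (eval a') = A := by
            ext i j; simp only [Matrix.map_apply, Matrix.of_apply, eval_X, a', Sum.elim_inl]
          have hX : (Matrix.of fun (i : Fin r) (j : Fin t) => X (Sum.inr (Sum.inl (i, j))) :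
              Matrix (Fin r) (Fin t) (MvPolynomial _ K)).map (eval a') = Xm := by
            ext i j; simp only [Matrix.map_apply, Matrix.of_apply, eval_X, a', Sum.elim_inr, Sum.elim_inl]
          have hY : (Matrix.of fun (i : Fin t) (j : Fin r) => X (Sum.inr (Sum.inr (i, j))) :
              Matrix (Fin t) (Fin r) (MvPolynomial _ K)).map (eval a') = Y := by
            ext i j; simp only [Matrix.map_apply, Matrix.of_apply, eval_X, a', Sum.elim_inr]
          congr 1
          · ext I i
            simp only [Matrix.of_apply, θ, submatrix_apply, id]
            rw [← Matrix.map_apply (f := eval a'), fromRows_map, Matrix.map_mul, hA, hY]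
          · ext i J
            simp only [Matrix.of_apply, θ, submatrix_apply, id]
            rw [← Matrix.map_apply (f := eval a'), fromCols_map, hX,
              Matrix.map_one _ (map_zero _) (map_one _)]
        have hPa : eval a P = 0 := by
          rw [hP, ← aeval_pointMap, funext (eval_gramComp a), ← hBa, ← hCa, ← hθ,
            ← funext (eval_gramComp (fun u => eval a' (θ u)))]
          have h1 : (fun H => eval (fun u => eval a' (θ u)) (φ H)) =
              fun H => eval a' ((fun H => aeval θ (φ H)) H) := by
            funext H
            exact congrFun (funext fun q => (aeval_pointMap θ a' q)) (φ H)
          rw [h1, aeval_pointMap, hp, map_zero]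
        rw [hPa, zero_mul]
    -- `D ≠ 0`: it takes the value `1` at `B = [1; 0]`, `C = [1 | 0]`
    have hD0 : D ≠ 0 := by
      intro h0
      let a₀ : (DegIdx σ k × Fin r) ⊕ (Fin r × DegIdx σ k) → K := fun u => match u with
        | Sum.inl Ii => (Matrix.fromRows (1 : Matrix (Fin r) (Fin r) K) (0 : Matrix (Fin t) (Fin r) K))
            (e Ii.1) Ii.2
        | Sum.inr iJ => (Matrix.fromCols (1 : Matrix (Fin r) (Fin r) K) (0 : Matrix (Fin r) (Fin t) K))
            iJ.1 (e iJ.2)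
      have h1 : eval a₀ D = 1 := by
        rw [hD, map_mul, RingHom.map_det, RingHom.map_det, RingHom.mapMatrix_apply,
          RingHom.mapMatrix_apply, ← Matrix.submatrix_map, ← Matrix.submatrix_map, hBv, hCv]
        have hB1 : (Matrix.of fun I i => a₀ (Sum.inl (I, i))).submatrix (fun i => e.symm (Sum.inl i)) id =
            (1 : Matrix (Fin r) (Fin r) K) := by
          ext i j
          simp only [submatrix_apply, Matrix.of_apply, a₀, Equiv.apply_symm_apply, fromRows_apply_inl, id]
        have hC1 : (Matrix.of fun i J => a₀ (Sum.inr (i, J))).submatrix id (fun j => e.symm (Sum.inl j)) =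
            (1 : Matrix (Fin r) (Fin r) K) := by
          ext i j
          simp only [submatrix_apply, Matrix.of_apply, a₀, Equiv.apply_symm_apply, fromCols_apply_inl, id]
        rw [hB1, hC1, Matrix.det_one, mul_one]
      rw [h0, map_zero] at h1
      exact zero_ne_one h1
    exact (mul_eq_zero.1 hPD).resolve_right hD0

/-- **Yabe 2015, Thm. 2.4, part (ii): `dim S̄ ≤ r(2s_k − r)`** for `r ≤ s_k` — the coordinate ring of
the closure of `S = {brank ≤ r}` has Krull dimension at most `r(2s_k − r)`, over every infinite (in
particular every algebraically closed) field. [cite: Yabe2015, Theorem 2.4] -/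
theorem ringKrullDim_quotient_vanishingIdeal_bRank_le [Infinite K] {k r : ℕ}
    (hr : r ≤ (degMonomials σ k).card) :
    ringKrullDim (MvPolynomial (DegIdx σ (2 * k)) K ⧸ MvPolynomial.vanishingIdeal K
        (formCoeff (2 * k) '' {q : MvPolynomial σ K | q.IsHomogeneous (2 * k) ∧ bRank k q ≤ r})) ≤
      (r * (2 * (degMonomials σ k).card - r) : ℕ) := by
  classical
  -- split the index set of `𝓘_k` into `r + (s_k - r)`
  obtain ⟨t, ht⟩ : ∃ t, (degMonomials σ k).card = r + t := ⟨_, (Nat.add_sub_cancel' hr).symm⟩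
  have hcard : Fintype.card (DegIdx σ k) = r + t := by rw [Fintype.card_coe, ht]
  let e : DegIdx σ k ≃ Fin r ⊕ Fin t := (Fintype.equivFinOfCardEq hcard).trans finSumFinEquiv.symm
  rw [← range_gramMap_eq, ← range_pointMap_gram, vanishingIdeal_range_eq_ker]
  refine (ringKrullDim_quotient_le_of_ker_eq _ _ (ker_gramComp_eq_ker_chartComp e)).trans ?_
  rw [ht, Nat.card_eq_fintype_card]
  simp only [Fintype.card_sum, Fintype.card_prod, Fintype.card_fin]
  apply le_of_eq
  congr 1
  rw [show 2 * (r + t) - r = r + t + t by omega]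
  ring

end Dimension

end Yabe

/-! ## The named fact holds -/

/-- **Yabe 2015, Theorem 2.4 — DISCHARGED** (p0005:L133–L135): over an algebraically closed field
of characteristic `0` (only "infinite" is used), for `r ≤ s_k`, the Zariski closure of
`S = {q ∈ K[x]^{(2k)} | brank(q) ≤ r} ⊆ K^{s_{2k}}` is irreducible (`I(S)` is prime) of dimension
`≤ r(2s_k − r)` (Krull dimension of `K[𝓘_{2k}]/I(S)`).  Proof: `S` is the image of
`(B, C) ↦ π(BC)` (Thm. 2.1), so `I(S)` is the kernel of a map into a domain; and that kernel equals
the kernel of the comorphism of the chart `(A,X,Y) ↦ π([[A,AX],[YA,YAX]])` with `r(2s_k − r)`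
parameters, whence `dim = trdeg ≤ r(2s_k − r)`. [cite: Yabe2015, Theorem 2.4] -/
theorem yabe2015_thm_2_4_holds : yabe2015_thm_2_4 := by
  intro K _ _ _ σ _ _ k r hr S
  exact ⟨Yabe.isPrime_vanishingIdeal_bRank_le k r, Yabe.ringKrullDim_quotient_vanishingIdeal_bRank_le hr⟩

end Literature.Computability.AlgebraicComplexity
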